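import Literature.Analysis.OperatorTheory.YangMillsMatrixModelCoreRellich
import Literature.Analysis.UnboundedOperators.CoreFormLevels
import HarnessLib

/-!
# AL1, weak half: an `L²`-orthonormal weak eigenbasis of Lüscher's matrix-model Hamiltonian realising `physLevel`

Topic `Literature/Analysis/OperatorTheory`; sibling of `YangMillsMatrixModelEigenfunctions.lean` (the named fact AL1
`LuscherHamiltonianEigenfunctions k`: smooth, colour-invariant, exponentially decaying classical eigenfunctions for the
first `k+1` invariant min–max levels of `𝔥 = −½Δ + V` on `ℝ⁹`).  This file PROVES dictionary item (1) of that fact —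
Reed–Simon IV, Thm XIII.64 (iv)⇒(v) with Thm XIII.2 for the Friedrichs operator of `𝔮` on the closure of the invariant
`C²_c` core:

★ `exists_weakEigenbasis_physLevel` — there is an ORTHONORMAL SEQUENCE `u₀, u₁, …` in `L²(ℝ⁹)`, each `u_k` in the
`L²`-closure of the invariant test functions, with the WEAK EIGEN-EQUATION `∫ u_k · 𝔥g = physLevel (k+1) · ∫ u_k · g` for
every invariant test function `g` (`(𝔥 − E_k) u_k = 0` distributionally on the invariant sector, `E_k = physLevel (k+1)`);
`exists_weakEigenfamily_physLevel` is the AL1-shaped `Fin (k+1)` restriction.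

Proof = the generic tree theorem `Literature.Analysis.UnboundedOperators.exists_core_form_eigenseq` (orthonormal weak
eigenfunctions realising the subspace min–max levels over a form core, given Kato's datum `(V, ι, S)` and Rellich on the
core) instantiated with: `V = T(C)`, the invariant core `C = coreSubmodule` realised inside `⨁_{11} L²(ℝ⁹)` by the feature
map `T ψ = (ψ, √V·ψ, (∂_pψ/√2)_p)` of `YangMillsMatrixModelCoreRellich.lean` (so `‖Tψ‖² = ‖ψ‖² + 𝔮(ψ)` and NO new
inner-product instance is declared); `ι` = first feature; `S = 𝔥` on the core; `hS` = Green's identity; Rellich =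
`totallyBounded_core`; `¬ FiniteDimensional` from the shell functions; and the levels are identified with
`physLevel (k+1)` by transporting the Rayleigh sets onto the tree's `levelSet (k+1)` along `C ≅ T(C)`.
§1 builds the datum lemma by lemma (each statement carries `Ψ = T⁻¹`, `ι`, `S` with their defining equations: all
transports are term-mode, since rewriting under the continuous linear map `ι` is expensive to elaborate); §2 assembles.

NOT addressed here: items (2) smoothness ∕ classical equation and (3) `ExpDecay₂` of AL1 (elliptic regularity —
`YangMillsMatrixModelWeakSolutions.lean` — and Agmon estimates).  Theorems only: no definitions, no named facts, no
instances, no notation.  NOT a claim about any gap.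

## References
* [ReedSimonIV1978] M. Reed, B. Simon, *Methods of Modern Mathematical Physics IV* (1978), §XIII.1 Thms XIII.1–2,
  §XIII.14 Thm XIII.64 ((iv) ⇒ (v)).
* [Kato1966] T. Kato, *Perturbation Theory for Linear Operators*, VI §1.3–§2.1 (closable forms, first representation
  theorem).
-/

noncomputable section

open MeasureTheory Filter Topology Real
open scoped InnerProductSpace BigOperators

namespace Literature.Analysis.OperatorTheory.YMMatrixModel

/-! ### §1. The `(V, ι, S)` datum of `exists_core_form_eigenseq` for `V = T(C)` -/

section CoreSpace

variable {C : Submodule ℝ (ZM → ℝ)} (hC : ∀ f : C, IsTestFn (f : ZM → ℝ) ∧ IsGaugeInv (f : ZM → ℝ))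
  (T : C →ₗ[ℝ] PiLp 2 (fun _ : Option (Option (Fin 3 × Fin 3)) => Lp ℝ 2 (volume : Measure ZM)))
  (hT0 : ∀ f : C, (T f) none = (memLp_two_of_isTestFn (hC f).1).toLp _)
  (hT1 : ∀ f : C, (T f) (some none) = (memLp_two_sqrtPot_of_isTestFn (hC f).1).toLp _)
  (hT2 : ∀ (f : C) (p : Fin 3 × Fin 3),
    (T f) (some (some p)) = (memLp_two_const_mul_pderiv_of_isTestFn (hC f).1 (Real.sqrt 2)⁻¹ p).toLp _)

/- In the lemmas below `Ψ : T(C) ≃ C` is the inverse of `T`, `ι` the first feature (the embedding into `L²`) and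
`S = 𝔥` on the core; they are passed as hypotheses with their defining equations. -/

include hT0 hT1 hT2 in
/-- The form identity on `T(C)`: `⟪v, w⟫ = ⟪𝔥(Ψv), Ψw⟫_{L²} + ⟪Ψv, Ψw⟫_{L²}` (Green). [cite: ReedSimonIV1978, Thm. XIII.2] -/
theorem coreMap_form_identity (Ψ : LinearMap.range T ≃ₗ[ℝ] C) (hTΨ : ∀ v : LinearMap.range T, T (Ψ v) = (v : PiLp 2 (fun _ : Option (Option (Fin 3 × Fin 3)) => Lp ℝ 2 (volume : Measure ZM))))
    (ι : LinearMap.range T →L[ℝ] Lp ℝ 2 (volume : Measure ZM))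
    (hι : ∀ v : LinearMap.range T, ι v = (memLp_two_of_isTestFn (hC (Ψ v)).1).toLp _)
    (S : LinearMap.range T → Lp ℝ 2 (volume : Measure ZM))
    (hSdef : ∀ v, S v = (memLp_two_hApply_of_isTestFn (hC (Ψ v)).1).toLp _) (v w : LinearMap.range T) :
    ⟪v, w⟫_ℝ = ⟪S v, ι w⟫_ℝ + ⟪ι v, ι w⟫_ℝ := by
  have key0 : ⟪(v : PiLp 2 (fun _ : Option (Option (Fin 3 × Fin 3)) => Lp ℝ 2 (volume : Measure ZM))), (w : PiLp 2 (fun _ : Option (Option (Fin 3 × Fin 3)) => Lp ℝ 2 (volume : Measure ZM)))⟫_ℝ = ⟪T (Ψ v), T (Ψ w)⟫_ℝ :=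
    congrArg₂ (fun a b => ⟪a, b⟫_ℝ) (hTΨ v).symm (hTΨ w).symm
  have key := key0.trans (inner_coreMap hC T hT0 hT1 hT2 (Ψ v) (Ψ w))
  have e1 : ⟪S v, ι w⟫_ℝ = ∫ x, hApply (Ψ v : ZM → ℝ) x * (Ψ w : ZM → ℝ) x :=
    (congrArg₂ (fun a b => ⟪a, b⟫_ℝ) (hSdef v) (hι w)).trans (inner_toLp_toLp _ _)
  have e2 : ⟪ι v, ι w⟫_ℝ = ∫ x, (Ψ v : ZM → ℝ) x * (Ψ w : ZM → ℝ) x :=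
    (congrArg₂ (fun a b => ⟪a, b⟫_ℝ) (hι v) (hι w)).trans (inner_toLp_toLp _ _)
  have hcomm : ∫ x, hApply (Ψ v : ZM → ℝ) x * (Ψ w : ZM → ℝ) x = ∫ x, (Ψ w : ZM → ℝ) x * hApply (Ψ v : ZM → ℝ) x :=
    integral_congr_ae (Eventually.of_forall fun x => mul_comm _ _)
  calc ⟪v, w⟫_ℝ = ⟪(v : PiLp 2 (fun _ : Option (Option (Fin 3 × Fin 3)) => Lp ℝ 2 (volume : Measure ZM))), (w : PiLp 2 (fun _ : Option (Option (Fin 3 × Fin 3)) => Lp ℝ 2 (volume : Measure ZM)))⟫_ℝ := Submodule.coe_inner _ v w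
    _ = _ := key
    _ = ⟪S v, ι w⟫_ℝ + ⟪ι v, ι w⟫_ℝ := by linarith [e1, e2, hcomm]

include hT0 hT1 hT2 in
/-- The form data on `T(C)`: `𝔮(Ψv) = ‖v‖² − ‖ιv‖²` and `‖Ψv‖²_{L²} = ‖ιv‖²`. [cite: ReedSimonIV1978, Thm. XIII.2] -/
theorem coreMap_form_data (Ψ : LinearMap.range T ≃ₗ[ℝ] C) (hTΨ : ∀ v : LinearMap.range T, T (Ψ v) = (v : PiLp 2 (fun _ : Option (Option (Fin 3 × Fin 3)) => Lp ℝ 2 (volume : Measure ZM))))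
    (ι : LinearMap.range T →L[ℝ] Lp ℝ 2 (volume : Measure ZM)) (hιE : ∀ v : LinearMap.range T, ι v = (v : PiLp 2 (fun _ : Option (Option (Fin 3 × Fin 3)) => Lp ℝ 2 (volume : Measure ZM))) none)
    (v : LinearMap.range T) :
    energyForm (Ψ v : ZM → ℝ) = ‖v‖ ^ 2 - ‖ι v‖ ^ 2 ∧ l2sq (Ψ v : ZM → ℝ) = ‖ι v‖ ^ 2 := by
  have h1 : ‖v‖ ^ 2 = l2sq (Ψ v : ZM → ℝ) + energyForm (Ψ v : ZM → ℝ) := by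
    have h0 : ‖v‖ ^ 2 = ‖T (Ψ v)‖ ^ 2 := by rw [hTΨ v]; rfl
    exact h0.trans (norm_coreMap_sq hC T hT0 hT1 hT2 (Ψ v))
  have h2 : ‖ι v‖ ^ 2 = l2sq (Ψ v : ZM → ℝ) := by
    have h0 : ι v = (T (Ψ v)) none := (hιE v).trans (congrArg (fun z : PiLp 2 (fun _ : Option (Option (Fin 3 × Fin 3)) => Lp ℝ 2 (volume : Measure ZM)) => z none) (hTΨ v)).symm
    exact (congrArg (fun a => ‖a‖ ^ 2) h0).trans (norm_coreMap_zero_sq hC T hT0 (Ψ v))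
  exact ⟨by linarith, h2.symm⟩

/-- Rellich on `T(C)`: `ι` maps norm balls to totally bounded sets of `L²` (from `totallyBounded_core`).
[cite: ReedSimonIV1978, Thm. XIII.65] -/
theorem coreMap_totallyBounded (Ψ : LinearMap.range T ≃ₗ[ℝ] C)
    (ι : LinearMap.range T →L[ℝ] Lp ℝ 2 (volume : Measure ZM))
    (hι : ∀ v : LinearMap.range T, ι v = (memLp_two_of_isTestFn (hC (Ψ v)).1).toLp _)
    (hq : ∀ v : LinearMap.range T,
      energyForm (Ψ v : ZM → ℝ) = ‖v‖ ^ 2 - ‖ι v‖ ^ 2 ∧ l2sq (Ψ v : ZM → ℝ) = ‖ι v‖ ^ 2) (r : ℝ) :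
    TotallyBounded (ι '' Metric.closedBall (0 : LinearMap.range T) r) := by
  refine TotallyBounded.subset ?_ (totallyBounded_core (r ^ 2))
  rintro _ ⟨v, hv, rfl⟩
  rw [Metric.mem_closedBall, dist_zero_right] at hv
  refine ⟨(Ψ v : ZM → ℝ), (hC (Ψ v)).1, (hC (Ψ v)).2, ?_, ?_⟩
  · exact (Filter.EventuallyEq.of_eq
      (congrArg (fun z : Lp ℝ 2 (volume : Measure ZM) => (z : ZM → ℝ)) (hι v))).trans (MemLp.coeFn_toLp _)
  · have h1 := (hq v).1
    have h2 := (hq v).2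
    have h3 : ‖v‖ ^ 2 ≤ r ^ 2 := pow_le_pow_left₀ (norm_nonneg _) hv 2
    linarith

include hC in
/-- The Rayleigh sets of `T(C)` (in the `(V, ι)` format) are the tree's `levelSet (k+1)` (transport along
`Φ = C.subtype ∘ Ψ : T(C) → (ℝ⁹ → ℝ)`, passed with its defining equation).
[cite: ReedSimonIV1978, Thm. XIII.1–2] -/
theorem coreMap_levelSet (hCmem : ∀ ψ : ZM → ℝ, IsTestFn ψ → IsGaugeInv ψ → ψ ∈ C)
    (Ψ : LinearMap.range T ≃ₗ[ℝ] C) (hΨT : ∀ f : C, Ψ ⟨T f, LinearMap.mem_range_self T f⟩ = f)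
    (Φ : LinearMap.range T →ₗ[ℝ] (ZM → ℝ)) (hΦ : ∀ v, Φ v = (Ψ v : ZM → ℝ))
    (ι : LinearMap.range T →L[ℝ] Lp ℝ 2 (volume : Measure ZM))
    (hq : ∀ v : LinearMap.range T,
      energyForm (Ψ v : ZM → ℝ) = ‖v‖ ^ 2 - ‖ι v‖ ^ 2 ∧ l2sq (Ψ v : ZM → ℝ) = ‖ι v‖ ^ 2) (k : ℕ) :
    {s : ℝ | ∃ W : Submodule ℝ (LinearMap.range T), Module.finrank ℝ W = k + 1 ∧
      ∀ f ∈ W, ‖f‖ ^ 2 - ‖ι f‖ ^ 2 ≤ s * ‖ι f‖ ^ 2} = levelSet (k + 1) := by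
  have hΦinj : Function.Injective Φ := fun v w h =>
    Ψ.injective (Subtype.ext (((hΦ v).symm.trans h).trans (hΦ w)))
  have hΦrange : ∀ ψ : ZM → ℝ, IsTestFn ψ ∧ IsGaugeInv ψ → ψ ∈ LinearMap.range Φ := by
    rintro ψ ⟨hψ, hψg⟩
    refine ⟨⟨T ⟨ψ, hCmem ψ hψ hψg⟩, LinearMap.mem_range_self T _⟩, ?_⟩
    rw [hΦ, hΨT]
  ext s
  constructor
  · rintro ⟨W, hW, hWs⟩
    refine ⟨W.map Φ, ?_, ?_, ?_⟩
    · rw [← (Submodule.equivMapOfInjective Φ hΦinj W).finrank_eq, hW]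
    · intro ψ hψ
      obtain ⟨f, -, rfl⟩ := Submodule.mem_map.1 hψ
      rw [hΦ]; exact hC (Ψ f)
    · intro ψ hψ
      obtain ⟨f, hf, rfl⟩ := Submodule.mem_map.1 hψ
      rw [hΦ]
      calc energyForm (Ψ f : ZM → ℝ) = ‖f‖ ^ 2 - ‖ι f‖ ^ 2 := (hq f).1
        _ ≤ s * ‖ι f‖ ^ 2 := hWs f hf
        _ = s * l2sq (Ψ f : ZM → ℝ) := congrArg (fun t => s * t) (hq f).2.symm
  · rintro ⟨W', hW', hW'C, hW's⟩
    have hle : W' ≤ LinearMap.range Φ := fun ψ hψ => hΦrange ψ (hW'C ψ hψ)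
    refine ⟨W'.comap Φ, ?_, ?_⟩
    · have hmap : (W'.comap Φ).map Φ = W' := by
        rw [Submodule.map_comap_eq]; exact inf_eq_right.2 hle
      rw [(Submodule.equivMapOfInjective Φ hΦinj _).finrank_eq, hmap, hW']
    · intro f hf
      have h1 := hW's _ (Submodule.mem_comap.1 hf)
      rw [hΦ] at h1
      calc ‖f‖ ^ 2 - ‖ι f‖ ^ 2 = energyForm (Ψ f : ZM → ℝ) := (hq f).1.symm
        _ ≤ s * l2sq (Ψ f : ZM → ℝ) := h1
        _ = s * ‖ι f‖ ^ 2 := congrArg (fun t => s * t) (hq f).2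

/-- The range of `ι` is the set of `L²`-classes of invariant test functions. [cite: ReedSimonIV1978, Thm. XIII.2] -/
theorem range_coreEmbedding (hCmem : ∀ ψ : ZM → ℝ, IsTestFn ψ → IsGaugeInv ψ → ψ ∈ C)
    (Ψ : LinearMap.range T ≃ₗ[ℝ] C) (hΨT : ∀ f : C, Ψ ⟨T f, LinearMap.mem_range_self T f⟩ = f)
    (ι : LinearMap.range T →L[ℝ] Lp ℝ 2 (volume : Measure ZM))
    (hι : ∀ v : LinearMap.range T, ι v = (memLp_two_of_isTestFn (hC (Ψ v)).1).toLp _) :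
    Set.range ι = {v : Lp ℝ 2 (volume : Measure ZM) |
      ∃ ψ : ZM → ℝ, IsTestFn ψ ∧ IsGaugeInv ψ ∧ (v : ZM → ℝ) =ᵐ[volume] ψ} := by
  ext v
  constructor
  · rintro ⟨w, rfl⟩
    exact ⟨(Ψ w : ZM → ℝ), (hC (Ψ w)).1, (hC (Ψ w)).2,
      (Filter.EventuallyEq.of_eq
        (congrArg (fun z : Lp ℝ 2 (volume : Measure ZM) => (z : ZM → ℝ)) (hι w))).trans (MemLp.coeFn_toLp _)⟩
  · rintro ⟨ψ, hψ, hψg, hv⟩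
    refine ⟨⟨T ⟨ψ, hCmem ψ hψ hψg⟩, LinearMap.mem_range_self T _⟩, ?_⟩
    have h1 : ι ⟨T ⟨ψ, hCmem ψ hψ hψg⟩, LinearMap.mem_range_self T _⟩ = (memLp_two_of_isTestFn hψ).toLp _ := by
      rw [hι, hΨT]
    rw [h1]
    exact Lp.ext ((MemLp.coeFn_toLp _).trans hv.symm)

/-- Reading the weak eigen-equation `⟪u, S w₀⟫ = μ ⟪u, ι w₀⟫` at the core point `w₀ = T g` as
`∫ u·𝔥g = μ ∫ u·g`. [cite: ReedSimonIV1978, Thm. XIII.64] -/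
theorem weak_eq_of_core (hCmem : ∀ ψ : ZM → ℝ, IsTestFn ψ → IsGaugeInv ψ → ψ ∈ C)
    (Ψ : LinearMap.range T ≃ₗ[ℝ] C) (hΨT : ∀ f : C, Ψ ⟨T f, LinearMap.mem_range_self T f⟩ = f)
    (ι : LinearMap.range T →L[ℝ] Lp ℝ 2 (volume : Measure ZM))
    (hι : ∀ v : LinearMap.range T, ι v = (memLp_two_of_isTestFn (hC (Ψ v)).1).toLp _)
    (S : LinearMap.range T → Lp ℝ 2 (volume : Measure ZM))
    (hSdef : ∀ v, S v = (memLp_two_hApply_of_isTestFn (hC (Ψ v)).1).toLp _)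
    (u : Lp ℝ 2 (volume : Measure ZM)) (μ : ℝ) {g : ZM → ℝ} (hg : IsTestFn g) (hgg : IsGaugeInv g)
    (h : ⟪u, S ⟨T ⟨g, hCmem g hg hgg⟩, LinearMap.mem_range_self T _⟩⟫_ℝ =
      μ * ⟪u, ι ⟨T ⟨g, hCmem g hg hgg⟩, LinearMap.mem_range_self T _⟩⟫_ℝ) :
    ∫ x, u x * hApply g x = μ * ∫ x, u x * g x := by
  have hΨw : Ψ ⟨T ⟨g, hCmem g hg hgg⟩, LinearMap.mem_range_self T _⟩ = ⟨g, hCmem g hg hgg⟩ := hΨT _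
  have e1 : ⟪u, S ⟨T ⟨g, hCmem g hg hgg⟩, LinearMap.mem_range_self T _⟩⟫_ℝ = ∫ x, u x * hApply g x := by
    have h1 : S ⟨T ⟨g, hCmem g hg hgg⟩, LinearMap.mem_range_self T _⟩ = (memLp_two_hApply_of_isTestFn hg).toLp _ := by
      rw [hSdef, hΨw]
    exact (congrArg (fun a => ⟪u, a⟫_ℝ) h1).trans (inner_toLp_right _ _)
  have e2 : ⟪u, ι ⟨T ⟨g, hCmem g hg hgg⟩, LinearMap.mem_range_self T _⟩⟫_ℝ = ∫ x, u x * g x := by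
    have h1 : ι ⟨T ⟨g, hCmem g hg hgg⟩, LinearMap.mem_range_self T _⟩ = (memLp_two_of_isTestFn hg).toLp _ := by
      rw [hι, hΨw]
    exact (congrArg (fun a => ⟪u, a⟫_ℝ) h1).trans (inner_toLp_right _ _)
  rw [← e1, ← e2]
  exact h

include hT0 hT1 hT2 in
/-- **The weak eigenbasis, core form.**  Given ANY realisation `T` of the invariant core `C` by its features (hypotheses
`hT0`–`hT2`) with `C` = all invariant test functions, the conclusion of `exists_weakEigenbasis_physLevel` holds.  Proof: apply
`exists_core_form_eigenseq` to `V = T(C) ⊆ ⨁_I L²`, `ι = ` first feature, `S = 𝔥` on the core (`hS` = the feature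
identity, Rellich = `totallyBounded_core`), and identify the levels with `physLevel (k+1)` by transporting the Rayleigh
sets along `C ≅ T(C)`. [cite: ReedSimonIV1978, Thm. XIII.64 ((iv) ⇒ (v)) and Thm. XIII.2] -/
theorem exists_weakEigenbasis_of_coreMap (hCmem : ∀ ψ : ZM → ℝ, IsTestFn ψ → IsGaugeInv ψ → ψ ∈ C) :
    ∃ u : ℕ → Lp ℝ 2 (volume : Measure ZM),
      Orthonormal ℝ u ∧
      (∀ k, u k ∈ closure {v : Lp ℝ 2 (volume : Measure ZM) |
          ∃ ψ : ZM → ℝ, IsTestFn ψ ∧ IsGaugeInv ψ ∧ (v : ZM → ℝ) =ᵐ[volume] ψ}) ∧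
      ∀ (k : ℕ) (g : ZM → ℝ), IsTestFn g → IsGaugeInv g →
        ∫ x, u k x * hApply g x = physLevel (k + 1) * ∫ x, u k x * g x := by
  have hTinj := coreMap_injective hC T hT0
  have hV := not_finiteDimensional_range_coreMap hC T hT0 hCmem
  -- the inverse `Ψ : T(C) ≃ C`
  obtain ⟨Ψ, hTΨ⟩ : ∃ Ψ : LinearMap.range T ≃ₗ[ℝ] C, ∀ v : LinearMap.range T, T (Ψ v) = (v : PiLp 2 (fun _ : Option (Option (Fin 3 × Fin 3)) => Lp ℝ 2 (volume : Measure ZM))) :=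
    ⟨(LinearEquiv.ofInjective T hTinj).symm, fun v => LinearEquiv.ofInjective_symm_apply T (h := hTinj) v⟩
  have hΨT : ∀ f : C, Ψ ⟨T f, LinearMap.mem_range_self T f⟩ = f := fun f =>
    hTinj (hTΨ ⟨T f, LinearMap.mem_range_self T f⟩)
  -- the embedding `ι` (first feature) and the operator `S = 𝔥` on the core
  obtain ⟨ι, hιE⟩ : ∃ ι : LinearMap.range T →L[ℝ] Lp ℝ 2 (volume : Measure ZM),
      ∀ v : LinearMap.range T, ι v = (v : PiLp 2 (fun _ : Option (Option (Fin 3 × Fin 3)) => Lp ℝ 2 (volume : Measure ZM))) none :=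
    ⟨(PiLp.proj 2 (𝕜 := ℝ) (fun _ : Option (Option (Fin 3 × Fin 3)) => Lp ℝ 2 (volume : Measure ZM)) none).comp (LinearMap.range T).subtypeL,
      fun v => rfl⟩
  have hι : ∀ v : LinearMap.range T, ι v = (memLp_two_of_isTestFn (hC (Ψ v)).1).toLp _ := by
    intro v
    have h1 : (T (Ψ v)) none = (memLp_two_of_isTestFn (hC (Ψ v)).1).toLp _ := hT0 (Ψ v)
    have h2 : (T (Ψ v)) none = (v : PiLp 2 (fun _ : Option (Option (Fin 3 × Fin 3)) => Lp ℝ 2 (volume : Measure ZM))) none := by rw [hTΨ v]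
    exact (hιE v).trans (h2.symm.trans h1)
  obtain ⟨S, hSdef⟩ : ∃ S : LinearMap.range T → Lp ℝ 2 (volume : Measure ZM),
      ∀ v, S v = (memLp_two_hApply_of_isTestFn (hC (Ψ v)).1).toLp _ := ⟨_, fun v => rfl⟩
  have hq := coreMap_form_data hC T hT0 hT1 hT2 Ψ hTΨ ι hιE
  -- the abstract theorem (Reed–Simon XIII.64 (iv)⇒(v) + XIII.2 on a form core)
  obtain ⟨u, μ, hon, -, -, -, hcl, hweak, hglb⟩ :=
    Literature.Analysis.UnboundedOperators.exists_core_form_eigenseq hV ι S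
      (coreMap_form_identity hC T hT0 hT1 hT2 Ψ hTΨ ι hι S hSdef) (coreMap_totallyBounded hC T Ψ ι hι hq)
  -- the levels are the tree's `physLevel (k+1)`
  have hμ : ∀ k, μ k = physLevel (k + 1) := by
    intro k
    have hset := coreMap_levelSet hC T hCmem Ψ hΨT (C.subtype.comp Ψ.toLinearMap) (fun v => rfl) ι hq k
    have hne : (levelSet (k + 1)).Nonempty := levelSet_nonempty _
    rw [physLevel_eq_sInf, ← hset]
    rw [← hset] at hne
    exact ((hglb k).csInf_eq hne).symm
  -- read back on functions
  have hrange := range_coreEmbedding hC T hCmem Ψ hΨT ι hι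
  refine ⟨u, hon, fun k => by rw [← hrange]; exact hcl k, fun k g hg hgg => ?_⟩
  rw [← hμ k]
  have h := hweak k ⟨T ⟨g, hCmem g hg hgg⟩, LinearMap.mem_range_self T _⟩
  have h' := weak_eq_of_core hC T hCmem Ψ hΨT ι hι S hSdef (u k) _ hg hgg h
  simpa only [RCLike.ofReal_real_eq_id, id_eq] using h'

end CoreSpace

/-! ### §2. The weak eigenbasis (Reed–Simon XIII.64 (iv)⇒(v) + XIII.2 for Lüscher's `𝔮` on the invariant core) -/

section Weak

/-- **AL1, weak half — an `L²(ℝ⁹)`-orthonormal weak eigenbasis of `𝔥 = −½Δ + V` on the colour-invariant sector,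
realising the min–max levels `physLevel`** (Reed–Simon IV, Thm XIII.64 (iv)⇒(v) with Thm XIII.2, for the Friedrichs
operator of Lüscher's form `𝔮` on the closure of the invariant `C²_c` core): there is an orthonormal sequence
`u₀, u₁, …` in `L²(ℝ⁹)`, each `u_k` in the `L²`-closure of the invariant test functions, with the WEAK EIGEN-EQUATION
`∫ u_k · 𝔥g = physLevel (k+1) · ∫ u_k · g` for every invariant test function `g` (i.e. `(𝔥 − E_k) u_k = 0` in the sense of
distributions on the invariant sector, `E_k = physLevel (k+1)` the `k`-th min–max level).  Assembly: the core
`C` = invariant test functions, realised in `⨁_{11} L²(ℝ⁹)` by the features `ψ, √Vψ, ∂_pψ/√2` (so that the feature norm is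
`‖ψ‖² + 𝔮(ψ)` with NO new instance), and `exists_weakEigenbasis_of_coreMap`.  This is dictionary item (1) of the named
fact `LuscherHamiltonianEigenfunctions` (AL1) as a THEOREM; items (2) smoothness and (3) `ExpDecay₂` of AL1
(elliptic regularity, Agmon) are NOT addressed here. [cite: ReedSimonIV1978, Thm. XIII.64 ((iv) ⇒ (v)) and Thm. XIII.2] -/
theorem exists_weakEigenbasis_physLevel :
    ∃ u : ℕ → Lp ℝ 2 (volume : Measure ZM),
      Orthonormal ℝ u ∧
      (∀ k, u k ∈ closure {v : Lp ℝ 2 (volume : Measure ZM) |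
          ∃ ψ : ZM → ℝ, IsTestFn ψ ∧ IsGaugeInv ψ ∧ (v : ZM → ℝ) =ᵐ[volume] ψ}) ∧
      ∀ (k : ℕ) (g : ZM → ℝ), IsTestFn g → IsGaugeInv g →
        ∫ x, u k x * hApply g x = physLevel (k + 1) * ∫ x, u k x * g x := by
  -- the core `C = coreSubmodule` of invariant test functions
  have hC : ∀ f : coreSubmodule, IsTestFn (f : ZM → ℝ) ∧ IsGaugeInv (f : ZM → ℝ) := fun f => f.2
  have hCmem : ∀ ψ : ZM → ℝ, IsTestFn ψ → IsGaugeInv ψ → ψ ∈ coreSubmodule := fun ψ h1 h2 => ⟨h1, h2⟩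
  -- the features `ψ, √Vψ, ∂_pψ/√2` of a core function, as `L²` classes
  let feat : coreSubmodule → Option (Option (Fin 3 × Fin 3)) → Lp ℝ 2 (volume : Measure ZM) := fun f i =>
    match i with
    | none => (memLp_two_of_isTestFn (hC f).1).toLp _
    | some none => (memLp_two_sqrtPot_of_isTestFn (hC f).1).toLp _
    | some (some p) => (memLp_two_const_mul_pderiv_of_isTestFn (hC f).1 (Real.sqrt 2)⁻¹ p).toLp _
  have feat_add : ∀ f g : coreSubmodule, feat (f + g) = feat f + feat g := by
    intro f g
    funext i
    match i with
    | none =>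
      show (memLp_two_of_isTestFn (hC (f + g)).1).toLp _ =
        (memLp_two_of_isTestFn (hC f).1).toLp _ + (memLp_two_of_isTestFn (hC g).1).toLp _
      rw [← MemLp.toLp_add]
      exact MemLp.toLp_congr _ _ (Eventually.of_forall fun x => rfl)
    | some none =>
      show (memLp_two_sqrtPot_of_isTestFn (hC (f + g)).1).toLp _ =
        (memLp_two_sqrtPot_of_isTestFn (hC f).1).toLp _ + (memLp_two_sqrtPot_of_isTestFn (hC g).1).toLp _
      rw [← MemLp.toLp_add]
      exact MemLp.toLp_congr _ _ (Eventually.of_forall fun x => by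
        simp only [Submodule.coe_add, Pi.add_apply, mul_add])
    | some (some p) =>
      show (memLp_two_const_mul_pderiv_of_isTestFn (hC (f + g)).1 (Real.sqrt 2)⁻¹ p).toLp _ =
        (memLp_two_const_mul_pderiv_of_isTestFn (hC f).1 (Real.sqrt 2)⁻¹ p).toLp _ +
          (memLp_two_const_mul_pderiv_of_isTestFn (hC g).1 (Real.sqrt 2)⁻¹ p).toLp _
      rw [← MemLp.toLp_add]
      exact MemLp.toLp_congr _ _ (Eventually.of_forall fun x => by
        simp only [Submodule.coe_add, Pi.add_apply,
          pderiv_add (hC f).1.differentiable (hC g).1.differentiable p, mul_add])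
  have feat_smul : ∀ (c : ℝ) (f : coreSubmodule), feat (c • f) = c • feat f := by
    intro c f
    funext i
    match i with
    | none =>
      show (memLp_two_of_isTestFn (hC (c • f)).1).toLp _ = c • (memLp_two_of_isTestFn (hC f).1).toLp _
      rw [← MemLp.toLp_const_smul]
      exact MemLp.toLp_congr _ _ (Eventually.of_forall fun x => rfl)
    | some none =>
      show (memLp_two_sqrtPot_of_isTestFn (hC (c • f)).1).toLp _ =
        c • (memLp_two_sqrtPot_of_isTestFn (hC f).1).toLp _
      rw [← MemLp.toLp_const_smul]
      exact MemLp.toLp_congr _ _ (Eventually.of_forall fun x => by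
        simp only [Submodule.coe_smul, Pi.smul_apply, smul_eq_mul]; ring)
    | some (some p) =>
      show (memLp_two_const_mul_pderiv_of_isTestFn (hC (c • f)).1 (Real.sqrt 2)⁻¹ p).toLp _ =
        c • (memLp_two_const_mul_pderiv_of_isTestFn (hC f).1 (Real.sqrt 2)⁻¹ p).toLp _
      rw [← MemLp.toLp_const_smul]
      exact MemLp.toLp_congr _ _ (Eventually.of_forall fun x => by
        simp only [Submodule.coe_smul, Pi.smul_apply, smul_eq_mul, pderiv_smul (hC f).1.differentiable c p]; ring)
  -- the feature map
  let T : coreSubmodule →ₗ[ℝ] PiLp 2 (fun _ : Option (Option (Fin 3 × Fin 3)) => Lp ℝ 2 (volume : Measure ZM)) :=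
    { toFun := fun f => WithLp.toLp 2 (feat f)
      map_add' := fun f g => by
        show WithLp.toLp 2 (feat (f + g)) = WithLp.toLp 2 (feat f) + WithLp.toLp 2 (feat g)
        rw [feat_add, WithLp.toLp_add]
      map_smul' := fun c f => by
        show WithLp.toLp 2 (feat (c • f)) = c • WithLp.toLp 2 (feat f)
        rw [feat_smul, WithLp.toLp_smul] }
  exact exists_weakEigenbasis_of_coreMap hC T (fun f => rfl) (fun f => rfl) (fun f p => rfl) hCmem

/-- **AL1-shaped corollary** (the first `k+1` weak eigenfunctions): for every `k` there are `L²`-orthonormal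
`u_0, …, u_k` in the `L²`-closure of the invariant test functions with `∫ u_j · 𝔥g = physLevel (j+1) · ∫ u_j · g` for all
invariant test `g` — the named fact `LuscherHamiltonianEigenfunctions k` with «`C^∞` + classical equation + `ExpDecay₂`»
replaced by «weak equation in `L²`». [cite: ReedSimonIV1978, Thm. XIII.64 ((iv) ⇒ (v)) and Thm. XIII.2] -/
theorem exists_weakEigenfamily_physLevel (k : ℕ) :
    ∃ u : Fin (k + 1) → Lp ℝ 2 (volume : Measure ZM),
      Orthonormal ℝ u ∧
      (∀ j, u j ∈ closure {v : Lp ℝ 2 (volume : Measure ZM) |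
          ∃ ψ : ZM → ℝ, IsTestFn ψ ∧ IsGaugeInv ψ ∧ (v : ZM → ℝ) =ᵐ[volume] ψ}) ∧
      ∀ (j : Fin (k + 1)) (g : ZM → ℝ), IsTestFn g → IsGaugeInv g →
        ∫ x, u j x * hApply g x = physLevel ((j : ℕ) + 1) * ∫ x, u j x * g x := by
  obtain ⟨u, hon, hcl, hweak⟩ := exists_weakEigenbasis_physLevel
  exact ⟨fun j => u j, hon.comp _ Fin.val_injective, fun j => hcl j, fun j g hg hgg => hweak j g hg hgg⟩

end Weak

end Literature.Analysis.OperatorTheory.YMMatrixModel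

end
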